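import Mathlib.Analysis.Calculus.MeanValue
import Mathlib.Analysis.Calculus.Deriv.Inv
import Mathlib.Analysis.SpecialFunctions.Log.Deriv
import Mathlib.Analysis.InnerProductSpace.PiL2
import Mathlib.Topology.Order.IntermediateValue
import Literature.Geometry.Lorentzian.MinkowskiGlobalHyperbolicity

/-!
# The coordinate lever of `stub_flatZoneSojourn`: a priori bounds and cone confinement for the
# chart geodesic ODE (helper for line `sojourn-needs-only-one-over-delta` of crux
`StarvedNecks.HonestFixedRadiusSettling`, item stmt-FinalStateConjecture-13550)

Pure real analysis, no geometry. A `C¹` pair `(z, v) : ℝ → E4 × E4` with `z' = v`, `v' = a` on a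
parameter interval `[s, t]` models the 1-jet of a null geodesic read in a flat chart whose metric
components are `η + e`, `|e|, |∂e| ≤ δ`: nullness gives `‖v‖² ≤ 3 (v⁰)²` and the Christoffel bound
gives `|a⁰| ≤ C δ (v⁰)²` (both only while `z` stays in the coordinate cone where the deviation is
controlled). We prove:

* `estimates_of_confined`: if the two bounds hold on `[s, t]`, `0 < v⁰(s) ≤ L` and
  `C δ L (t - s) < 1`, then on `[s, t]` the chart rate obeys the Riccati comparison
  `0 < v⁰(u) ≤ L / (1 - C δ L (u - s))` (one-sided Grönwall for `1/v⁰`, whose derivative is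
  `≥ -C δ`), the chart time obeys `0 ≤ z⁰(t) - z⁰(s) ≤ -log (1 - C δ L (t - s)) / (C δ)`, and the
  spatial displacement obeys `‖z⃗(t) - z⃗(s)‖ ≤ √2 (z⁰(t) - z⁰(s))` (slope `< 2`);
* `cone_confinement`: consequently, if the bounds are only known while `z` is in the closed cone
  `K = {x | z⁰(s) ≤ x⁰ ≤ z⁰(s) + T, ‖x⃗ - z⃗(s)‖ ≤ 2 (x⁰ - z⁰(s)) + 1}`, then for
  `t ≤ s + (1 - e^{-CδT})/(CδL)` the curve stays in `K` on `[s, t]` (continuous induction,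
  `IsClosed.Icc_subset_of_forall_mem_nhdsGT_of_Icc_subset`) and `‖v‖ ≤ 2 L e^{CδT}` there.

Read backwards, `(1 - e^{-CδT})/(CδL)` is the affine parameter a chart-null curve entering with
rate `≤ L` needs before it can leave the slab of chart height `T`: the lever of the line. The
constants `C`, `δ` only enter through `C δ`; `L` is the entry-rate bound.
-/

noncomputable section

set_option linter.dupNamespace false

open Literature.Geometry.Lorentzian
open scoped Manifold ContDiff ENNReal Topology
open Filter Set Topology

namespace Summit.FinalStateConjecture.FinalStateConjecture.Theorems.StarvedNecks.OneOverDelta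

/-- From the null-cone estimate `‖v‖² ≤ 3 (v⁰)²` and `0 ≤ v⁰`: the spatial speed is at most
`√2 v⁰` and the full speed at most `2 v⁰`. -/
theorem norm_spatial_le_of_null {v : E4} (h : ‖v‖ ^ 2 ≤ 3 * v 0 ^ 2) (h0 : 0 ≤ v 0) :
    ‖E4.spatial v‖ ≤ Real.sqrt 2 * v 0 ∧ ‖v‖ ≤ 2 * v 0 := by
  have hsq := Minkowski.norm_sq_eq_time_sq_add_norm_spatial_sq v
  constructor
  · have h2 : ‖E4.spatial v‖ ^ 2 ≤ (Real.sqrt 2 * v 0) ^ 2 := by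
      rw [mul_pow, Real.sq_sqrt (by norm_num : (0 : ℝ) ≤ 2)]
      linarith
    exact (pow_le_pow_iff_left₀ (norm_nonneg _) (by positivity) two_ne_zero).1 h2
  · have h2 : ‖v‖ ^ 2 ≤ (2 * v 0) ^ 2 := by
      have : (2 * v 0) ^ 2 = 4 * v 0 ^ 2 := by ring
      rw [this]; nlinarith [sq_nonneg (v 0)]
    exact (pow_le_pow_iff_left₀ (norm_nonneg _) (by positivity) two_ne_zero).1 h2

/-- **A priori bounds under confinement** (one-sided Grönwall read backwards). Let `z' = v`,
`v' = a` on `[s, t]` with `v ≠ 0`, the null-cone estimate `‖v‖² ≤ 3 (v⁰)²` and the Christoffel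
bound `|a⁰| ≤ C δ (v⁰)²` there, `0 < v⁰(s) ≤ L` and `C δ L (t - s) < 1`. Then on `[s, t]`:
`0 < v⁰(u) ≤ L / (1 - C δ L (u - s))` (the Riccati comparison for `1/v⁰`, whose derivative is
`≥ -Cδ`); the chart time `z⁰` is nondecreasing and `z⁰(t) - z⁰(s) ≤ -log(1 - CδL(t - s))/(Cδ)`
(integrate the rate bound); and `‖z⃗(t) - z⃗(s)‖ ≤ √2 (z⁰(t) - z⁰(s))` (the spatial speed is
`≤ √2 v⁰ = √2 (z⁰)'`, fencing inequality). -/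
theorem estimates_of_confined {z v a : ℝ → E4} {s t L δ C : ℝ}
    (hC : 0 < C) (hδ : 0 < δ) (hv0 : 0 < v s 0) (hL : v s 0 ≤ L) (hst : s ≤ t)
    (ht : C * δ * L * (t - s) < 1)
    (hz : ∀ u ∈ Icc s t, HasDerivAt z (v u) u) (hv : ∀ u ∈ Icc s t, HasDerivAt v (a u) u)
    (hne : ∀ u ∈ Icc s t, v u ≠ 0)
    (hnull : ∀ u ∈ Icc s t, ‖v u‖ ^ 2 ≤ 3 * v u 0 ^ 2)
    (hacc : ∀ u ∈ Icc s t, |a u 0| ≤ C * δ * v u 0 ^ 2) :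
    (∀ u ∈ Icc s t, 0 < v u 0 ∧ v u 0 ≤ L / (1 - C * δ * L * (u - s))) ∧
    z s 0 ≤ z t 0 ∧
    z t 0 - z s 0 ≤ -Real.log (1 - C * δ * L * (t - s)) / (C * δ) ∧
    ‖E4.spatial (z t) - E4.spatial (z s)‖ ≤ Real.sqrt 2 * (z t 0 - z s 0) := by
  have hLpos : 0 < L := hv0.trans_le hL
  have hCδ : 0 < C * δ := mul_pos hC hδ
  have hCδL : 0 < C * δ * L := mul_pos hCδ hLpos
  -- derivatives of the time components
  have hz0 : ∀ u ∈ Icc s t, HasDerivAt (fun u ↦ z u 0) (v u 0) u := fun u hu ↦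
    (EuclideanSpace.proj (0 : Fin 4) : E4 →L[ℝ] ℝ).hasFDerivAt.comp_hasDerivAt u (hz u hu)
  have hv0d : ∀ u ∈ Icc s t, HasDerivAt (fun u ↦ v u 0) (a u 0) u := fun u hu ↦
    (EuclideanSpace.proj (0 : Fin 4) : E4 →L[ℝ] ℝ).hasFDerivAt.comp_hasDerivAt u (hv u hu)
  have hv0c : ContinuousOn (fun u ↦ v u 0) (Icc s t) := fun u hu ↦
    (hv0d u hu).continuousAt.continuousWithinAt
  have hden : ∀ u ∈ Icc s t, 0 < 1 - C * δ * L * (u - s) := by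
    intro u hu
    have : C * δ * L * (u - s) ≤ C * δ * L * (t - s) :=
      mul_le_mul_of_nonneg_left (by linarith [hu.2]) hCδL.le
    linarith
  -- (a) the time component of the velocity never vanishes, hence stays positive
  have hv0ne : ∀ u ∈ Icc s t, v u 0 ≠ 0 := by
    intro u hu h0
    have h1 := hnull u hu
    rw [h0] at h1
    have h3 : ‖v u‖ = 0 := by nlinarith [norm_nonneg (v u)]
    exact hne u hu (norm_eq_zero.1 h3)
  have hpos : ∀ u ∈ Icc s t, 0 < v u 0 := by
    intro u hu
    by_contra hle
    push Not at hle
    have hcont : ContinuousOn (fun u ↦ v u 0) (Icc s u) :=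
      hv0c.mono (Icc_subset_Icc le_rfl hu.2)
    have hmem : (0 : ℝ) ∈ Icc (v u 0) (v s 0) := ⟨hle, hv0.le⟩
    obtain ⟨c, hc, hc0⟩ := intermediate_value_Icc' hu.1 hcont hmem
    exact hv0ne c ⟨hc.1, hc.2.trans hu.2⟩ hc0
  -- (b) Riccati comparison for `r = 1 / v⁰`: `r' = -a⁰/(v⁰)² ≥ -Cδ`
  have hr : ∀ u ∈ Icc s t, HasDerivAt (fun u ↦ (v u 0)⁻¹ + C * δ * (u - s))
      (-(a u 0) / v u 0 ^ 2 + C * δ) u := by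
    intro u hu
    have h1 := (hv0d u hu).inv (hv0ne u hu)
    have h2 : HasDerivAt (fun u : ℝ ↦ C * δ * (u - s)) (C * δ) u := by
      simpa using ((hasDerivAt_id u).sub_const s).const_mul (C * δ)
    exact h1.add h2
  have hmono : MonotoneOn (fun u ↦ (v u 0)⁻¹ + C * δ * (u - s)) (Icc s t) := by
    refine monotoneOn_of_deriv_nonneg (convex_Icc s t)
      (fun u hu ↦ (hr u hu).continuousAt.continuousWithinAt)
      (fun u hu ↦ (hr u (interior_subset hu)).differentiableAt.differentiableWithinAt)
      (fun u hu ↦ ?_)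
    have hu' : u ∈ Icc s t := interior_subset hu
    rw [(hr u hu').deriv]
    have h1 := (abs_le.1 (hacc u hu')).2
    have h2 : 0 < v u 0 ^ 2 := pow_pos (hpos u hu') 2
    have h3 : -(C * δ) ≤ -(a u 0) / v u 0 ^ 2 := by
      rw [le_div_iff₀ h2]
      linarith
    linarith
  have hrate : ∀ u ∈ Icc s t, 0 < v u 0 ∧ v u 0 ≤ L / (1 - C * δ * L * (u - s)) := by
    intro u hu
    refine ⟨hpos u hu, ?_⟩
    have h1 := hmono (left_mem_Icc.2 hst) hu hu.1
    simp only [sub_self, mul_zero, add_zero] at h1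
    have h2 : L⁻¹ ≤ (v s 0)⁻¹ := inv_anti₀ hv0 hL
    have h3 : L⁻¹ - C * δ * (u - s) ≤ (v u 0)⁻¹ := by linarith
    have h4 : L⁻¹ - C * δ * (u - s) = (1 - C * δ * L * (u - s)) / L := by
      field_simp
    rw [h4] at h3
    have h5 : 0 < (1 - C * δ * L * (u - s)) / L := div_pos (hden u hu) hLpos
    calc v u 0 = ((v u 0)⁻¹)⁻¹ := (inv_inv _).symm
      _ ≤ ((1 - C * δ * L * (u - s)) / L)⁻¹ := inv_anti₀ h5 h3
      _ = L / (1 - C * δ * L * (u - s)) := by rw [inv_div]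
  refine ⟨hrate, ?_, ?_, ?_⟩
  · -- (d) chart time is nondecreasing
    have hmz : MonotoneOn (fun u ↦ z u 0) (Icc s t) :=
      monotoneOn_of_deriv_nonneg (convex_Icc s t)
        (fun u hu ↦ (hz0 u hu).continuousAt.continuousWithinAt)
        (fun u hu ↦ (hz0 u (interior_subset hu)).differentiableAt.differentiableWithinAt)
        (fun u hu ↦ by
          rw [(hz0 u (interior_subset hu)).deriv]
          exact (hpos u (interior_subset hu)).le)
    exact hmz (left_mem_Icc.2 hst) (right_mem_Icc.2 hst) hst
  · -- (c) chart time against the comparison function `-log(1 - CδL(u-s))/(Cδ)`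
    have hp : ∀ u ∈ Icc s t, HasDerivAt
        (fun u ↦ z u 0 + Real.log (1 - C * δ * L * (u - s)) / (C * δ))
        (v u 0 + (1 - C * δ * L * (u - s))⁻¹ * (-(C * δ * L)) / (C * δ)) u := by
      intro u hu
      have h1 : HasDerivAt (fun u : ℝ ↦ 1 - C * δ * L * (u - s)) (-(C * δ * L)) u := by
        simpa using (((hasDerivAt_id u).sub_const s).const_mul (C * δ * L)).const_sub 1
      have h2 := ((Real.hasDerivAt_log (hden u hu).ne').comp u h1).div_const (C * δ)
      exact (hz0 u hu).add h2
    have hanti : AntitoneOn (fun u ↦ z u 0 + Real.log (1 - C * δ * L * (u - s)) / (C * δ))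
        (Icc s t) := by
      refine antitoneOn_of_deriv_nonpos (convex_Icc s t)
        (fun u hu ↦ (hp u hu).continuousAt.continuousWithinAt)
        (fun u hu ↦ (hp u (interior_subset hu)).differentiableAt.differentiableWithinAt)
        (fun u hu ↦ ?_)
      have hu' : u ∈ Icc s t := interior_subset hu
      rw [(hp u hu').deriv]
      have h1 := (hrate u hu').2
      have h2 := hden u hu'
      have h3 : (1 - C * δ * L * (u - s))⁻¹ * (-(C * δ * L)) / (C * δ) =
          -(L / (1 - C * δ * L * (u - s))) := by
        field_simp
      rw [h3]
      linarith
    have h1 := hanti (left_mem_Icc.2 hst) (right_mem_Icc.2 hst) hst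
    simp only [sub_self, mul_zero, sub_zero, Real.log_one, zero_div, add_zero] at h1
    rw [neg_div]
    linarith
  · -- (e) spatial displacement, by the fencing inequality
    have hf : ∀ u ∈ Icc s t, HasDerivAt (fun u ↦ E4.spatial (z u) - E4.spatial (z s))
        (E4.spatial (v u)) u := fun u hu ↦
      (E4.spatial.hasFDerivAt.comp_hasDerivAt u (hz u hu)).sub_const _
    have hB : ∀ u ∈ Icc s t, HasDerivAt (fun u ↦ Real.sqrt 2 * (z u 0 - z s 0))
        (Real.sqrt 2 * v u 0) u := fun u hu ↦ by
      simpa using ((hz0 u hu).sub_const (z s 0)).const_mul (Real.sqrt 2)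
    have key := image_norm_le_of_norm_deriv_right_le_deriv_boundary'
      (f := fun u ↦ E4.spatial (z u) - E4.spatial (z s))
      (f' := fun u ↦ E4.spatial (v u)) (a := s) (b := t)
      (fun u hu ↦ (hf u hu).continuousAt.continuousWithinAt)
      (fun u hu ↦ (hf u (Ico_subset_Icc_self hu)).hasDerivWithinAt)
      (B := fun u ↦ Real.sqrt 2 * (z u 0 - z s 0)) (B' := fun u ↦ Real.sqrt 2 * v u 0)
      (by simp)
      (fun u hu ↦ (hB u hu).continuousAt.continuousWithinAt)
      (fun u hu ↦ (hB u (Ico_subset_Icc_self hu)).hasDerivWithinAt)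
      (fun u hu ↦ (norm_spatial_le_of_null (hnull u (Ico_subset_Icc_self hu))
        (hpos u (Ico_subset_Icc_self hu)).le).1)
    exact key (right_mem_Icc.2 hst)

/-- The sojourn parameter `(1 - e^{-CδT})/(CδL)` clears the Riccati blow-up: for
`s ≤ t ≤ s + (1 - e^{-CδT})/(CδL)` one has `e^{-CδT} ≤ 1 - CδL(t - s)` (so the comparison rate
`L/(1 - CδL(t - s))` is at most `L e^{CδT}`) and the comparison chart time
`-log(1 - CδL(t - s))/(Cδ)` is at most `T`, strictly so before the endpoint. -/
theorem comparison_bounds {s t L δ T C : ℝ} (hC : 0 < C) (hδ : 0 < δ) (hL : 0 < L)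
    (ht : t ≤ s + (1 - Real.exp (-(C * δ * T))) / (C * δ * L)) :
    Real.exp (-(C * δ * T)) ≤ 1 - C * δ * L * (t - s) ∧ C * δ * L * (t - s) < 1 ∧
    -Real.log (1 - C * δ * L * (t - s)) / (C * δ) ≤ T ∧
    (t < s + (1 - Real.exp (-(C * δ * T))) / (C * δ * L) →
      -Real.log (1 - C * δ * L * (t - s)) / (C * δ) < T) := by
  have hCδ : 0 < C * δ := mul_pos hC hδ
  have hCδL : 0 < C * δ * L := mul_pos hCδ hL
  have hexp : 0 < Real.exp (-(C * δ * T)) := Real.exp_pos _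
  have h1 : C * δ * L * (t - s) ≤ 1 - Real.exp (-(C * δ * T)) := by
    have : t - s ≤ (1 - Real.exp (-(C * δ * T))) / (C * δ * L) := by linarith
    rwa [le_div_iff₀' hCδL] at this
  have hle : Real.exp (-(C * δ * T)) ≤ 1 - C * δ * L * (t - s) := by linarith
  refine ⟨hle, by linarith, ?_, fun hlt ↦ ?_⟩
  · rw [div_le_iff₀ hCδ, neg_le]
    have := Real.log_le_log hexp hle
    rw [Real.log_exp] at this
    linarith
  · have h2 : C * δ * L * (t - s) < 1 - Real.exp (-(C * δ * T)) := by
      have : t - s < (1 - Real.exp (-(C * δ * T))) / (C * δ * L) := by linarith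
      rwa [lt_div_iff₀' hCδL] at this
    rw [div_lt_iff₀ hCδ, neg_lt]
    have := Real.log_lt_log hexp (show Real.exp (-(C * δ * T)) < 1 - C * δ * L * (t - s) by
      linarith)
    rw [Real.log_exp] at this
    linarith

/-- **Cone confinement** (the lever of the line, in coordinates). Let `z' = v`, `v' = a` on
`[s, t₁]` with `v ≠ 0`, `z(s) = y`, `0 < v⁰(s) ≤ L`, and suppose the null-cone estimate
`‖v‖² ≤ 3 (v⁰)²` and the Christoffel bound `|a⁰| ≤ Cδ (v⁰)²` hold at every parameter at which
`z` lies in the closed coordinate cone `K = {x | y⁰ ≤ x⁰ ≤ y⁰ + T, ‖x⃗ - y⃗‖ ≤ 2 (x⁰ - y⁰) + 1}`.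
If `t₁ ≤ s + (1 - e^{-CδT})/(CδL)` then `z` stays in `K` on all of `[s, t₁]`, with `v⁰ > 0` and
`‖v‖ ≤ 2 L e^{CδT}`. Proof: continuous induction on the closed condition `z(u) ∈ K`
(`IsClosed.Icc_subset_of_forall_mem_nhdsGT_of_Icc_subset`): if `z([s, t]) ⊆ K` with `t < t₁`
then `estimates_of_confined` gives at `t` the STRICT inequalities `z⁰(t) - y⁰ < T` (the comparison
chart time is `< T` before the endpoint, `comparison_bounds`) and `‖z⃗ - y⃗‖ ≤ √2 (z⁰ - y⁰) <
2 (z⁰ - y⁰) + 1`, which persist after `t` by continuity, while `z⁰ > z⁰(t) ≥ y⁰` just after `t`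
because `(z⁰)'(t) = v⁰(t) > 0`. -/
theorem cone_confinement_of_bounds {z v a : ℝ → E4} {y : E4} {s t₁ L δ T C : ℝ}
    (hC : 0 < C) (hδ : 0 < δ) (hT : 0 ≤ T) (hzs : z s = y) (hv0 : 0 < v s 0) (hL : v s 0 ≤ L)
    (ht₁ : t₁ ≤ s + (1 - Real.exp (-(C * δ * T))) / (C * δ * L))
    (hz : ∀ u ∈ Icc s t₁, HasDerivAt z (v u) u) (hv : ∀ u ∈ Icc s t₁, HasDerivAt v (a u) u)
    (hne : ∀ u ∈ Icc s t₁, v u ≠ 0)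
    (hnull : ∀ u ∈ Icc s t₁, y 0 ≤ z u 0 → z u 0 ≤ y 0 + T →
      ‖E4.spatial (z u) - E4.spatial y‖ ≤ 2 * (z u 0 - y 0) + 1 → ‖v u‖ ^ 2 ≤ 3 * v u 0 ^ 2)
    (hacc : ∀ u ∈ Icc s t₁, y 0 ≤ z u 0 → z u 0 ≤ y 0 + T →
      ‖E4.spatial (z u) - E4.spatial y‖ ≤ 2 * (z u 0 - y 0) + 1 →
        |a u 0| ≤ C * δ * v u 0 ^ 2) :
    ∀ u ∈ Icc s t₁, (y 0 ≤ z u 0 ∧ z u 0 ≤ y 0 + T ∧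
      ‖E4.spatial (z u) - E4.spatial y‖ ≤ 2 * (z u 0 - y 0) + 1) ∧
      0 < v u 0 ∧ ‖v u‖ ≤ 2 * L * Real.exp (C * δ * T) := by
  have hLpos : 0 < L := hv0.trans_le hL
  subst hzs
  -- the closed condition and the induction
  set S : Set ℝ := {u | z s 0 ≤ z u 0 ∧ z u 0 ≤ z s 0 + T ∧
    ‖E4.spatial (z u) - E4.spatial (z s)‖ ≤ 2 * (z u 0 - z s 0) + 1} with hS_def
  have hzc : ContinuousOn z (Icc s t₁) := fun u hu ↦ (hz u hu).continuousAt.continuousWithinAt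
  have hclosed : IsClosed (S ∩ Icc s t₁) := by
    have hK : IsClosed {x : E4 | z s 0 ≤ x 0 ∧ x 0 ≤ z s 0 + T ∧
        ‖E4.spatial x - E4.spatial (z s)‖ ≤ 2 * (x 0 - z s 0) + 1} := by
      have h0 : Continuous fun x : E4 ↦ x 0 := (EuclideanSpace.proj (0 : Fin 4) : E4 →L[ℝ] ℝ).continuous
      exact (isClosed_le continuous_const h0).inter ((isClosed_le h0 continuous_const).inter
        (isClosed_le (E4.spatial.continuous.sub continuous_const).norm
          ((continuous_const.mul (h0.sub continuous_const)).add continuous_const)))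
    rw [inter_comm]
    exact hzc.preimage_isClosed_of_isClosed isClosed_Icc hK
  have hsS : s ∈ S := ⟨le_rfl, by linarith, by simp⟩
  -- estimates on an initial segment confined to the cone
  have hest : ∀ t ∈ Icc s t₁, Icc s t ⊆ S →
      (∀ u ∈ Icc s t, 0 < v u 0 ∧ v u 0 ≤ L / (1 - C * δ * L * (u - s))) ∧
      z s 0 ≤ z t 0 ∧ z t 0 - z s 0 ≤ -Real.log (1 - C * δ * L * (t - s)) / (C * δ) ∧
      ‖E4.spatial (z t) - E4.spatial (z s)‖ ≤ Real.sqrt 2 * (z t 0 - z s 0) := by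
    intro t ht hconf
    have hsub : Icc s t ⊆ Icc s t₁ := Icc_subset_Icc le_rfl ht.2
    exact estimates_of_confined hC hδ hv0 hL ht.1
      (comparison_bounds hC hδ hLpos (ht.2.trans ht₁)).2.1
      (fun u hu ↦ hz u (hsub hu)) (fun u hu ↦ hv u (hsub hu)) (fun u hu ↦ hne u (hsub hu))
      (fun u hu ↦ hnull u (hsub hu) (hconf hu).1 (hconf hu).2.1 (hconf hu).2.2)
      (fun u hu ↦ hacc u (hsub hu) (hconf hu).1 (hconf hu).2.1 (hconf hu).2.2)
  have hstep : ∀ t ∈ Ico s t₁, Icc s t ⊆ S → S ∈ 𝓝[>] t := by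
    intro t ht hconf
    have ht' : t ∈ Icc s t₁ := ⟨ht.1, ht.2.le⟩
    obtain ⟨hrate, hmon, htime, hsp⟩ := hest t ht' hconf
    have hcmp := comparison_bounds hC hδ hLpos (ht.2.le.trans ht₁)
    have h1 : z t 0 < z s 0 + T := by linarith [hcmp.2.2.2 (ht.2.trans_le ht₁)]
    have h2 : ‖E4.spatial (z t) - E4.spatial (z s)‖ < 2 * (z t 0 - z s 0) + 1 := by
      have hs2 : Real.sqrt 2 ≤ 2 := by
        rw [Real.sqrt_le_left (by norm_num : (0:ℝ) ≤ 2)]; norm_num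
      nlinarith
    have h3 : 0 < v t 0 := (hrate t (right_mem_Icc.2 ht.1)).1
    have hzt : ContinuousAt z t := (hz t ht').continuousAt
    have h0c : Continuous fun x : E4 ↦ x 0 := (EuclideanSpace.proj (0 : Fin 4) : E4 →L[ℝ] ℝ).continuous
    have hev1 : ∀ᶠ u in 𝓝 t, z u 0 < z s 0 + T :=
      (h0c.continuousAt.comp hzt).eventually_lt continuousAt_const h1
    have hev2 : ∀ᶠ u in 𝓝 t,
        ‖E4.spatial (z u) - E4.spatial (z s)‖ < 2 * (z u 0 - z s 0) + 1 := by
      refine ContinuousAt.eventually_lt ?_ ?_ h2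
      · exact ((E4.spatial.continuous.continuousAt.comp hzt).sub continuousAt_const).norm
      · have hc : Continuous fun x : E4 ↦ 2 * (x 0 - z s 0) + 1 :=
          (continuous_const.mul (h0c.sub continuous_const)).add continuous_const
        exact hc.continuousAt.comp hzt
    have hev3 : ∀ᶠ u in 𝓝[>] t, z s 0 ≤ z u 0 := by
      have hd : HasDerivAt (fun u ↦ z u 0) (v t 0) t :=
        (EuclideanSpace.proj (0 : Fin 4) : E4 →L[ℝ] ℝ).hasFDerivAt.comp_hasDerivAt t (hz t ht')
      have hsl := (hd.tendsto_slope.mono_left (nhdsGT_le_nhdsNE t)).eventually (lt_mem_nhds h3)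
      filter_upwards [hsl, self_mem_nhdsWithin] with u hu hut
      rw [slope_def_field] at hu
      have := (div_pos_iff_of_pos_right (sub_pos.2 (mem_Ioi.1 hut))).1 hu
      linarith
    have : ∀ᶠ u in 𝓝[>] t, u ∈ S := by
      filter_upwards [hev3, (hev1.and hev2).filter_mono nhdsWithin_le_nhds] with u hu hu'
      exact ⟨hu, hu'.1.le, hu'.2.le⟩
    exact this
  have hall : Icc s t₁ ⊆ S := hclosed.Icc_subset_of_forall_mem_nhdsGT_of_Icc_subset hsS hstep
  -- conclusions
  intro u hu
  obtain ⟨hrate, -, -, -⟩ := hest u hu fun u' hu' ↦ hall ⟨hu'.1, hu'.2.trans hu.2⟩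
  have hcmp := comparison_bounds hC hδ hLpos (hu.2.trans ht₁)
  have huS : u ∈ S := hall hu
  obtain ⟨hvpos, hvle⟩ := hrate u (right_mem_Icc.2 hu.1)
  refine ⟨huS, hvpos, ?_⟩
  have h1 := (norm_spatial_le_of_null (hnull u hu huS.1 huS.2.1 huS.2.2) hvpos.le).2
  have h2 : L / (1 - C * δ * L * (u - s)) ≤ L * Real.exp (C * δ * T) := by
    rw [div_le_iff₀ (by linarith [hcmp.2.1]), mul_assoc]
    refine le_mul_of_one_le_right hLpos.le ?_
    have h3 := mul_le_mul_of_nonneg_left hcmp.1 (Real.exp_pos (C * δ * T)).le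
    rw [← Real.exp_add, add_neg_cancel, Real.exp_zero] at h3
    exact h3
  linarith

/-- **Cone confinement, registered form** (the sub-goal `cone_confinement` of crux item
stmt-FinalStateConjecture-13550, line `sojourn-needs-only-one-over-delta`): the statement of
`cone_confinement_of_bounds` as one closed proposition. -/
theorem cone_confinement : ∀ {z v a : ℝ → E4} {y : E4} {s t₁ L δ T C : ℝ}, 0 < C → 0 < δ → 0 ≤ T → z s = y → 0 < v s 0 → v s 0 ≤ L → t₁ ≤ s + (1 - Real.exp (-(C * δ * T))) / (C * δ * L) → (∀ u ∈ Icc s t₁, HasDerivAt z (v u) u) → (∀ u ∈ Icc s t₁, HasDerivAt v (a u) u) → (∀ u ∈ Icc s t₁, v u ≠ 0) → (∀ u ∈ Icc s t₁, y 0 ≤ z u 0 → z u 0 ≤ y 0 + T → ‖E4.spatial (z u) - E4.spatial y‖ ≤ 2 * (z u 0 - y 0) + 1 → ‖v u‖ ^ 2 ≤ 3 * v u 0 ^ 2) → (∀ u ∈ Icc s t₁, y 0 ≤ z u 0 → z u 0 ≤ y 0 + T → ‖E4.spatial (z u) - E4.spatial y‖ ≤ 2 * (z u 0 - y 0) + 1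 → |a u 0| ≤ C * δ * v u 0 ^ 2) → ∀ u ∈ Icc s t₁, (y 0 ≤ z u 0 ∧ z u 0 ≤ y 0 + T ∧ ‖E4.spatial (z u) - E4.spatial y‖ ≤ 2 * (z u 0 - y 0) + 1) ∧ 0 < v u 0 ∧ ‖v u‖ ≤ 2 * L * Real.exp (C * δ * T) :=
  fun hC hδ hT hzs hv0 hL ht₁ hz hv hne hnull hacc ↦
    cone_confinement_of_bounds hC hδ hT hzs hv0 hL ht₁ hz hv hne hnull hacc

end Summit.FinalStateConjecture.FinalStateConjecture.Theorems.StarvedNecks.OneOverDelta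

end
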